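import Literature.AlgebraicGeometry.Motives.AbelianVarietyIsogenyPullbackPushforward
import Literature.AlgebraicGeometry.Modules.PushforwardIsoUnit
import HarnessLib

/-!
# Direct image of a vector bundle along an isogeny is a vector bundle (named fact)

For a FINITE LOCALLY FREE morphism of schemes `f : X → Y` (Görtz–Wedhorn I, Prop. 12.19: `f` affine with `f_*𝒪_X` a finite
locally free `𝒪_Y`-module ⟺ `f` finite, flat and of finite presentation; over a locally noetherian `Y`: finite and flat) and a
finite locally free `𝒪_X`-module `F` of rank `r`, the direct image `f_*F` is a finite locally free `𝒪_Y`-module (of rank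
`r · deg f`): by Görtz–Wedhorn I, Prop. 12.13, `F ↦ f_*F` is an equivalence between finite locally free `𝒪_X`-modules and finite
locally free `f_*𝒪_X`-modules preserving the rank («If `𝓕` has rank `r`, then `f_*𝓕` has rank `r` (as `f_*𝒪_X`-module)»; the
point of the proof: `f` is closed with finite fibres, so the `f⁻¹(V)`, `V ∋ y`, are cofinal among the neighbourhoods of `f⁻¹(y)`
and `F` is free on some `f⁻¹(V)`, Lemma 7.43), and a locally free module of finite rank over the finite locally free
`𝒪_Y`-algebra `f_*𝒪_X` is a finite locally free `𝒪_Y`-module. An ISOGENY `g : A → B` of abelian varieties over a field `k` is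
finite (by definition: `AbelianVariety.IsIsogeny` = surjective ∧ finite; Mumford §7 Application 3, p. 63) and flat (the tree's
`IsIsogeny.flat_toSchemeHom_holds`, Görtz–Wedhorn II Prop. 27.54) between noetherian schemes, hence finite locally free of
degree `deg g`; so **`g_*F` is a vector bundle (of rank `r · deg g`) for every vector bundle `F` of rank `r` on `A`** — the
statement S. Mukai, *Semi-homogeneous vector bundles on an abelian variety* (1978), §3 and §5 (Prop. 5.4) computes with.

## Content (D-0014: a NAMED FACT — `def … : Prop`, no axiom; the PROVED degree-one instance is appended separately)

* `IsogenyPushforwardFiniteLocallyFree` — for an isogeny `g : A → B` of abelian varieties over a field `k` and a finite locally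
  free `𝒪_A`-module `F`, `g_*F` (Mathlib's `Scheme.Modules.pushforward`) is finite locally free (`IsFiniteLocallyFree`). NOT
  PROVED HERE: the tree has neither the module-level identification of `Γ(g⁻¹V, F)` as a projective `Γ(g⁻¹V, 𝒪_A)`-module for a
  finite locally free `F` on the affine `g⁻¹V` (Serre–Swan ∕ Stacks 00NX on a chart) nor the description of
  `Scheme.Modules.pushforward` along an affine morphism on charts as restriction of scalars (the chart formula exists only for
  pull-backs, `Modules.liftBaseChange_unitSectionLE_bijective`). Consumed by the Hodge road's THEOREM T
  (`Summits/HodgeConjecture/HodgeConjecture/Theorems/VHCAbelianSchemesRoadIsogenyPushforwardAdmissibilityTransfer`): the direct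
  image of a bounded complex of vector bundles along an isogeny is again one.
* (to be appended, proved: `isogenyPushforwardFiniteLocallyFree_of_isIso` — the degree-one case: along an isogeny which is an isomorphism of
  schemes the direct image of a vector bundle is a vector bundle (`IsFiniteLocallyFree.pushforward_of_iso`), showing the shape of
  the statement (Mathlib's push-forward of `𝒪`-modules, the tree's `IsFiniteLocallyFree`) is the intended one.

-- TODO(general form): any finite locally free morphism of schemes `f : X → Y` (Görtz–Wedhorn I Prop. 12.13 with Prop. 12.19),
-- with the rank statement `rk (f_*F) = deg f · rk F`.

## References
* [GortzWedhorn2020] U. Görtz, T. Wedhorn, Algebraic Geometry I: Schemes, 2nd ed. (2020), Prop. 12.13 (p. 410), §(12.6) Prop. 12.19 (p. 413), Lemma 7.43.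
* [GortzWedhorn2023] U. Görtz, T. Wedhorn, Algebraic Geometry II (2023), Prop. 27.54 (isogenies are flat), Prop. 27.177 (1).
* [MumfordAV1970] D. Mumford, Abelian Varieties (1970), §7 Application 3 (p. 63).
* [Mukai1978] S. Mukai, J. Math. Kyoto Univ. 18 (1978), §3 and §5 Prop. 5.4 (1) (p. 259).
-/

noncomputable section

open CategoryTheory CategoryTheory.Limits AlgebraicGeometry

universe u

namespace Literature.AlgebraicGeometry.Motives

open AbelianVariety

/-- **The direct image of a vector bundle along an isogeny is a vector bundle** (named fact): for an isogeny `g : A → B` of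
abelian varieties over a field `k` and a finite locally free `𝒪_A`-module `F`, the direct image `g_*F` is a finite locally free
`𝒪_B`-module. In print: `g` is finite (definition of isogeny) and flat (Görtz–Wedhorn II Prop. 27.54) between noetherian schemes,
hence finite locally free (Görtz–Wedhorn I Prop. 12.19); for a finite morphism `f`, `F ↦ f_*F` is a rank-preserving equivalence
between finite locally free `𝒪_X`-modules and finite locally free `f_*𝒪_X`-modules (Görtz–Wedhorn I Prop. 12.13), and a finite
locally free module over the finite locally free `𝒪_Y`-algebra `f_*𝒪_X` is a finite locally free `𝒪_Y`-module (of rank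
`deg f · rk F`). Stated for isogenies of abelian varieties (the consumers' case); see the module docstring for the general form.
[cite: GortzWedhorn2020, Prop. 12.13 (p. 410) with Prop. 12.19 (p. 413)] [cite: GortzWedhorn2023, Prop. 27.54]
[cite: Mukai1978, §5 Prop. 5.4 (1) (p. 259)] -/
def IsogenyPushforwardFiniteLocallyFree : Prop :=
  ∀ (k : Type u) [Field k] (A B : AbelianVariety k) (g : A ⟶ B), IsIsogeny g →
    ∀ (F : A.X.left.Modules), IsFiniteLocallyFree F →
      IsFiniteLocallyFree ((Scheme.Modules.pushforward (Hom.toSchemeHom g)).obj F)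

/-! ## Appended: the PROVED degree-one instance -/

/-- **Degree-one instance (PROVED): along an isogeny which is an isomorphism of the underlying schemes, the direct image of a
vector bundle is a vector bundle** — `g_*F ≅ (g⁻¹)^*F` is locally free (the tree's `IsFiniteLocallyFree.pushforward_of_iso`). The
case `deg g = 1` of `IsogenyPushforwardFiniteLocallyFree`, recorded to show that the shape of the named fact (Mathlib's
`Scheme.Modules.pushforward` of the underlying scheme morphism `Hom.toSchemeHom g`, the tree's `IsFiniteLocallyFree`) is the
intended, satisfiable one. [cite: GortzWedhorn2020, Prop. 12.13 (p. 410)] -/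
theorem isogenyPushforwardFiniteLocallyFree_of_isIso {k : Type u} [Field k] {A B : AbelianVariety k} (g : A ⟶ B)
    [IsIso (Hom.toSchemeHom g)] (F : A.X.left.Modules) (hF : IsFiniteLocallyFree F) :
    IsFiniteLocallyFree ((Scheme.Modules.pushforward (Hom.toSchemeHom g)).obj F) :=
  hF.pushforward_of_iso (asIso (Hom.toSchemeHom g))

/-- In particular for the identity isogeny: `(𝟙_A)_*F` is a vector bundle. [cite: GortzWedhorn2020, Prop. 12.13 (p. 410)] -/
theorem isogenyPushforwardFiniteLocallyFree_id {k : Type u} [Field k] (A : AbelianVariety k) (F : A.X.left.Modules)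
    (hF : IsFiniteLocallyFree F) :
    IsFiniteLocallyFree ((Scheme.Modules.pushforward (Hom.toSchemeHom (𝟙 A))).obj F) := by
  haveI : IsIso (Hom.toSchemeHom (𝟙 A)) := by
    change IsIso (𝟙 A.X.left)
    infer_instance
  exact isogenyPushforwardFiniteLocallyFree_of_isIso (𝟙 A) F hF

end Literature.AlgebraicGeometry.Motives

end
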